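import Literature.NumberTheory.EllipticCurves.PadicPointsFiltration
import Literature.NumberTheory.EllipticCurves.ManinConstantAdditivePrimesProofs
import HarnessLib

/-!
# `ord_p log_{ω_E}(P)` for a point `P ∈ E(K)` read in `E(ℚ_p)` along an embedding `K ↪ ℚ_p`
# (the local number of the anticyclotomic control theorems: CGLS 2022 Thm. 5.1.1, Castella 2018
# Thm. 2.3 / Thm. 3.2, Jetchev–Skinner–Wan 2017 Thm. 3.3.1 / §3.5)

HONEST FRAMING (cell `b2b-bsdres`, run/shared/lean/b2b/bsd-rank1-residual/, verbatim in every file):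
the goal of the cell is to DELETE the COMBINATION-SHAPED residual classes of the Birch–Swinnerton-Dyer
formula for ALL analytic-rank `≤ 1` elliptic curves over `ℚ` from PUBLISHED theorems only, so that
the remainder becomes exactly the CONSTRUCTION-SHAPED classes, which are TYPED, not attempted; this
is not "finishing BSD". Unit `b2b-bsdres-lit-cgls` (off-peak literature typer), session 5, sized ask
S1a / A1′ (a Literature home for the objects of the anticyclotomic control theorem). DEFINITIONS with
bodies (the READING of a printed symbol on tree objects) and two instances; nothing asserted; no
named fact; no `sorry`. Deprecate-and-add, phase "add": the declarations are those of the `Log`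
section of `Summits/BirchSwinnertonDyer/Rank1Residual/X11b/AnticyclotomicEmbedding.lean` (multr1)
re-homed with the same names, binders and bodies in `namespace Literature.NumberTheory.EllipticCurves`
(so the Summits twins `X11b.padicPointOf`, `X11b.formalIndex`, `X11b.padicLogOrd` are definitionally
equal to these).

## The printed symbol

Castella–Grossi–Lee–Skinner, Invent. Math. 227 (2022) Thm. 5.1.1 (arXiv:2008.02571v2 TeX
L2411–L2423): "`#ℤ_p/𝓕_E(0) = #Ш(E/K)[p^∞] · ( #(ℤ_p/((1−a_p+p)/p)·log_{ω_E} P) / [E(K):ℤ·P]_p )² ·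
∏_{w∣N} c_w(E/K)_p`, where `P ∈ E(K)` is any point of infinite order, `log_{ω_E} : E(K_v)_{/tors} →
ℤ_p` is the formal group logarithm associated to a Néron differential `ω_E`" (`p = v v̄` split in the
imaginary quadratic `K`, so `K_v = ℚ_p`). Castella, Camb. J. Math. 6 (2018) §2.2 (arXiv:1704.06608
p. 5): "Denote by `Ê` the formal group of `E`, and let `log_{ω_E} : E(ℚ_p) → ℤ_p` the formal group
logarithm attached to a fixed invariant differential `ω_E` on `Ê`"; Thm. 2.3: "`#ℤ_p/((1 − a_p p⁻¹ +
ε_p) log_{ω_E} P)`"; proof (p0005 L155): "The formal group logarithm defines an injective homomorphism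
`log_{ω_E} : E(K_𝔭)_{/tor} ⊗ ℤ_p → ℤ_p` mapping `E₁(K_𝔭)` isomorphically onto `pℤ_p`".

## The reading (tree objects only)

For `W/ℚ` GLOBALLY MINIMAL (so `ω = dx/(2y + a₁x + a₃)` is a Néron differential and `W ⊗ ℚ_p` is a
minimal, hence `ℤ_p`-integral, equation — `isMinimal_map_padic_of_isGloballyMinimal`), an embedding
`ι : K →+* ℚ_p` (for `p` split in `K`: the completion `K ↪ K_v = ℚ_p` at the prime `v` INDUCED BY
`ι`, as in CGLS §2 "with `v` the prime of `K` above `p` induced by `ι_p`") and `P ∈ E(K)`: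
`P_ι ∈ E(ℚ_p)` its image (`padicPointOf`), `m₀ = [E(ℚ_p) : E₁(ℚ_p)]` the index of the kernel of
reduction (`formalIndex`; `= c_p·#Ẽ_ns(𝔽_p)`, `index_formalFiltration`), `m₀ • P_ι ∈ E₁(ℚ_p)`
(`m₀ = index`, Lagrange) where the tree's `padicLogPoint = log_W ∘ z` (AEC IV.6.4 / VII.2.2) IS the
formal-group logarithm, and **`padicLogOrd W p ι P := ord_p log_W(z(m₀ • P_ι)) − ord_p m₀`** — the
valuation of the `ℤ_p`-linear extension `log P := log(m₀P)/m₀` of the formal logarithm to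
`E(ℚ_p) ⊗ ℤ_p` ("`log_{ω_E} : E(K_𝔭)_{/tor} ⊗ ℤ_p → ℤ_p`"). `Padic.valuation` has junk value `0` at
`0` (not met for `P` of infinite order at the intended use). A definition; nothing asserted.

References: [CastellaGrossiLeeSkinner2022] Thm. 5.1.1; [Castella2018] §2.2, Thm. 2.3 (arXiv:1704.06608
pp. 5–6); [JetchevSkinnerWan2017] Thm. 3.3.1, §3.5; [SilvermanAEC2009] IV.6.4, VII.2.1–2.2, VIII.8.
-/

noncomputable section

open scoped Classical

open WeierstrassCurve

namespace Literature.NumberTheory.EllipticCurves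

section Log

variable (W : WeierstrassCurve ℚ) (p : ℕ) [Fact p.Prime] {K : Type} [Field K] [NumberField K]

/-- **The image `P_ι ∈ E(ℚ_p)` of `P ∈ E(K)` along an embedding `ι : K →+* ℚ_p`** (for `p` split in
`K`: `P ∈ E(K) ⊂ E(K_v) = E(ℚ_p)` at the prime `v` induced by `ι`). Mathlib's
`WeierstrassCurve.Affine.Point.map`.
[cite: CastellaGrossiLeeSkinner2022, Thm. 5.1.1 ("`log_{ω_E} : E(K_v)_{/tors} → ℤ_p`", `P ∈ E(K)` read in `E(K_v)`)]
[cite: Castella2018, Thm. 2.3 (arXiv:1704.06608 p. 5), "`P ∈ E(K)`" read in `E(K_𝔭)`] -/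
def padicPointOf (ι : K →+* ℚ_[p]) (P : (W.baseChange K).toAffine.Point) :
    (W.baseChange ℚ_[p]).toAffine.Point :=
  WeierstrassCurve.Affine.Point.map ι.toRatAlgHom P

/-- `E ⊗ ℚ_p` is an elliptic curve when `E` is (instance plumbing through `baseChange = map`).
[folklore] -/
instance isElliptic_baseChange_padic [W.IsElliptic] : (W.baseChange ℚ_[p]).IsElliptic := by
  rw [baseChange]; infer_instance

/-- A globally minimal `W/ℚ` is `ℤ_p`-minimal, hence `ℤ_p`-integral, over `ℚ_p` (tree
`isMinimal_map_padic_of_isGloballyMinimal`; minimal ⇒ integral), so that the formal-group layer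
(`formalFiltration`, `padicLogPoint`) applies to `W ⊗ ℚ_p`.
[cite: SilvermanAEC2009, VIII.8 (global minimal equations)] -/
instance isIntegral_baseChange_padic [W.IsGloballyMinimal] : (W.baseChange ℚ_[p]).IsIntegral ℤ_[p] :=
  haveI : (W.baseChange ℚ_[p]).IsMinimal ℤ_[p] := isMinimal_map_padic_of_isGloballyMinimal W p
  inferInstance

/-- **`m₀ = [E(ℚ_p) : E₁(ℚ_p)]`**, the index of the kernel of reduction (the tree's
`formalFiltration 1`) for the globally minimal `W` read over `ℚ_p`; `= c_p · #Ẽ_ns(𝔽_p)`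
(`index_formalFiltration`). [cite: SilvermanAEC2009, VII.2 Prop. 2.1 and VII.6.1] -/
def formalIndex [W.IsElliptic] [W.IsGloballyMinimal] : ℕ :=
  ((W.baseChange ℚ_[p]).formalFiltration 1).index

/-- **`ord_p log_{ω_E}(P)` ON TREE OBJECTS** for `P ∈ E(K)` read in `E(ℚ_p)` along `ι`:
`ord_p log_W(z(m₀ • P_ι)) − ord_p m₀`, where `m₀ = [E(ℚ_p):E₁(ℚ_p)]`, `m₀ • P_ι ∈ E₁(ℚ_p)` is in the
domain where the tree's `padicLogPoint` (`log_W ∘ z`, AEC IV.6.4 / VII.2.2, for the equation `W`,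
minimal at `p` when `W` is globally minimal, so `ω = dx/(2y + a₁x + a₃)` is a Néron differential) IS
the formal-group logarithm, and the subtraction renormalises the `ℤ_p`-linear extension
`log P := log(m₀P)/m₀` — CGLS: "`log_{ω_E} : E(K_v)_{/tors} → ℤ_p` the formal group logarithm
associated to a Néron differential `ω_E`"; Castella: "`log_{ω_E} : E(K_𝔭)_{/tor} ⊗ ℤ_p → ℤ_p`".
`Padic.valuation` has junk value `0` at `0` (not met for `P` of infinite order). A definition (the
reading used by every anticyclotomic-control statement of the cell); nothing asserted.
[cite: CastellaGrossiLeeSkinner2022, Thm. 5.1.1 (the symbol `log_{ω_E} P`)]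
[cite: Castella2018, §2.2 and Thm. 2.3 (arXiv:1704.06608 pp. 5–6)] [cite: SilvermanAEC2009, IV.6.4 and VII.2.2] -/
def padicLogOrd [W.IsElliptic] [W.IsGloballyMinimal] (ι : K →+* ℚ_[p])
    (P : (W.baseChange K).toAffine.Point) : ℤ :=
  ((W.baseChange ℚ_[p]).padicLogPoint (formalIndex W p • padicPointOf W p ι P)).valuation -
    (padicValNat p (formalIndex W p) : ℤ)

end Log

end Literature.NumberTheory.EllipticCurves

end
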